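import Summits.Ventures.AbcSig.Rows.XTemplateHalves
import Summits.Ventures.AbcSig.Levels.N2504
import Summits.Ventures.AbcSig.Levels.N2504RB

/-!
# Venture AbcSig — ROW `C2aL313A45yodd`: `xⁿ + 2^a·313^m·yⁿ = z²`, class `a 45yodd` (GENERATED by plean/leanrow.py)

S-VARIANT (p-lean g6 `gen6/spatch.py`, after g5's xpatch): same statement shape as `row_C2aL313A45yodd` except that the residual pair(s) 2504.4 @ 11 — closed in the row of record by the certified prime-ideal SIEVE (no module; citation-backing audit plean/g5/THETAVERIFY-RECORD.md Part C, class INDEX-CITED) — are discharged IN THE KERNEL on the re-based presentation `rb_2504_<k>` (`Levels/N2504RB.lean`, `Recipes/SieveDischarge.lean`) under the COMPUTED hypothesis `hRB_… : ∀ f, Matches f orbit → Matches f rb` instead of being CITED; the plain-template proof is moved verbatim onto the X-templates (motive `Excludes ∨ ExcludesStd`, same argument order).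
HONEST FRAMING. A row of a COMPUTATION cell (`pub-abcsig`); a CONDITIONAL theorem, no claim on ABC or any summit.
Hypotheses: `BS04Package` (CITED), `DataComplete` at levels [2504] (COMPUTED, two-engine certified
level files), and the listed per-orbit exclusions `hX_…` (CITED — e.g. the cell's M6 Eisenstein certificates; the
row's R5 cell names each). Everything else is kernel-checked (`Rows/TemplateC2a.lean`, `Levels/N….lean`). Exponent
range: prime `n ≥ 11`, `n ≠ 313`; `B = 2^a 313^m` with `a, m < n` (n-th-power free). PARITY HALF: only solutions with y ODD (y = the variable whose coefficient carries the power of 2) are claimed; the y-even half of this cell is unresolved (lead RULING F14).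
Row of record:  (sha256 ; SIGNED 2026-08-22T10:05:22Z by referee (ref-g5)); its R0: THEOREM (sieve-complete) for all primes n >= 11 with n coprime to 5008 — class: candidate (a in {4,5} cell, y ODD only: the y-even sub-case lands at level 2l wh. Exponents left open by the row of record are excluded here via ; kernel-sieve residuals the row of record closes by a cell module (M6 Eisenstein / M4 Kraus certificates) appear as CITED hypotheses .
-/

namespace Summit.Ventures.AbcSig

/-- Row `C2aL313A45yodd` (see module docstring). -/
theorem xrow_C2aL313A45yoddS (M : NewformModel) (hP : M.BS04Package)
    (hD2504 : M.DataComplete 2504 level2504Orbits)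
    (n : ℕ) (hn : n.Prime) (hmin : 11 ≤ n) (hnℓ : n ≠ 313) (a m : ℕ) (ha : a = 4 ∨ a = 5) (hm : 1 ≤ m) (han : a < n) (hmn : m < n)
    (hRB_orbit_2504_4 : ∀ f : M.Form 2504, M.Matches f orbit_2504_4 → M.Matches f rb_2504_4)
    (x y z : ℤ) (hy : ¬ 2 ∣ y) (hxy1 : x * y ≠ 1) (hxy2 : x * y ≠ -1) : ¬ IsPrimitiveSolution 1 (2 ^ a * 313 ^ m) 1 n x y z := by
  have hℓ : Nat.Prime 313 := by norm_num
  have h7 : 7 ≤ n := by omega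
  have hS2504 :=
    (level2504_sieve n hn h7 (fun o => M.Excludes 2504 o (famB (2 ^ a * 313 ^ m) n (fun _ _ => True)) ∨ M.ExcludesStd 2504 o n) (fun h => absurd h (by simp only [List.mem_cons, List.not_mem_nil, or_false]; omega)) (fun h => absurd h (by simp only [List.mem_cons, List.not_mem_nil, or_false]; omega)) (fun hmem => by
      rcases (by simpa using hmem : n = 7 ∨ n = 11) with rfl | rfl
      · omega
      · exact Or.inr (orbit_2504_4_exclStd_11 M hP hRB_orbit_2504_4)) (fun h => absurd h (by simp only [List.mem_cons, List.not_mem_nil, or_false]; omega)))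
  exact xrowC2a_a45_yodd 313 hℓ (by norm_num) M hP n hn h7 hnℓ hD2504 a m ha hm han hmn
    hS2504 x y z hy hxy1 hxy2

end Summit.Ventures.AbcSig
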